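import Literature.NumberTheory.EllipticCurves.HeegnerPointsKolyvaginPrimaryDescentProofs
import HarnessLib

/-!
# Kolyvagin's bound on the order of `Ш(E/K)[p^∞]`: the quotient `Sel/ℤx` and pure eigen-lifts

Sibling proof file of `HeegnerPointsKolyvaginPrimaryOrderTelescopeProofs` (McCallum 1991, §5:
`∑ Nᵢ ≤ M₀` for isotropic independent eigen-lifts `sᵢ ∈ Sel`, from the Cassels–Tate value
formula and Čebotarev), supplying the algebra that turns a maximal isotropic subgroup of
`Ш(E/K)_{p^M} = Sel/ℤx` into such lifts. For Kolyvagin's descent data `S : HypothesesM V Pl`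
(`x = δ_M x₀` of order exactly `p^M`, `Sel = S_{p^M}(E/K)`, `τ` complex conjugation, `p` odd):

* `exists_pure_eigen_lift` — every class `z ∈ Sel` which is a `ν`-eigenclass modulo `ℤx`
  (`τ z - ν z ∈ ℤx`) is congruent modulo `ℤx` to a `ν`-eigenclass `z' ∈ Sel` which is **pure**:
  `a z' ∈ ℤx ⟹ a z' = 0` (so `ord z' = ord (z' mod ℤx)`). This is McCallum's "lift `dᵢ` to `cᵢ`
  in the Selmer group" (p. 312) at the finite level `p^M`: `ℤx ≅ ℤ/p^M` has the maximal order in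
  the `p^M`-torsion group `Sel`, hence is pure, and `2` is invertible.
* the quotient `Q = Sel/ℤx` (as `S.Sel ⧸ (ℤx).addSubgroupOf S.Sel`): `τ` and any bi-additive
  pairing `P` on `Sel` vanishing against `x` descend (`exists_quotient_involution`,
  `exists_quotient_pairing`), `Q` is finite of odd order when `Sel` is finite
  (`odd_card_quotient`), and `#Sel = p^M · #Q` (`card_sel_eq`).
* `indep_of_quotient_indep` — lifts `sᵢ` that are pure and independent modulo `ℤx` are
  independent together with `x`, in the form consumed by `sum_expo_le_M₀_of_casselsTate`.

Pure algebra; no definition and no named fact is introduced.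

## References

* W. G. McCallum, *Kolyvagin's work on Shafarevich–Tate groups*, in *`L`-functions and
  arithmetic (Durham, 1989)*, LMS Lecture Note Ser. 153, CUP (1991), 295–316: §5, proof of
  Thm. 5.4 (p. 312: "let `cᵢ` be a lifting of `dᵢ` to `S_∞(E/K)`"), Lemma 5.1 (`x₀`).
  [McCallumLMS1991]
-/

open scoped Classical

namespace Literature.NumberTheory.EllipticCurves

namespace KolyvaginDescent

namespace HypothesesM

variable {V : Type*} [AddCommGroup V] {Pl : Type*} (S : HypothesesM V Pl)

/-! ### Purity of `ℤx` and pure eigen-lifts -/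

/-- `ℤx` is pure in the `p^M`-torsion group `V`: if `p^n z ∈ ℤx` then `p^n (z - b' x) = 0` for some
`b'` (`ord x = p^M` is the exponent of `V`). [folklore] -/
private theorem exists_pow_zsmul_sub_eq_zero {z : V} {n : ℕ} {b : ℤ} (h : ((S.p : ℤ) ^ n) • z = b • S.x) :
    ∃ b' : ℤ, ((S.p : ℤ) ^ n) • (z - b' • S.x) = 0 := by
  have hp := S.hp
  rcases le_or_gt n S.M with hn | hn
  · have h0 : ((S.p : ℤ) ^ (S.M - n) * b) • S.x = 0 := by
      rw [mul_smul, ← h, smul_smul, ← pow_add, Nat.sub_add_cancel hn, S.torsion]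
    rw [S.zsmul_x_eq_zero_iff] at h0
    obtain ⟨b', hb'⟩ : ((S.p : ℤ) ^ n) ∣ b := by
      have : ((S.p : ℤ) ^ S.M) = (S.p : ℤ) ^ (S.M - n) * (S.p : ℤ) ^ n := by
        rw [← pow_add, Nat.sub_add_cancel hn]
      rw [this] at h0
      exact (mul_dvd_mul_iff_left (pow_ne_zero _ (by exact_mod_cast hp.ne_zero))).mp h0
    refine ⟨b', ?_⟩
    rw [smul_sub, h, hb', mul_smul, sub_self]
  · exact ⟨0, by rw [zero_smul, sub_zero]; exact pow_zsmul_eq_zero_of_le hn.le (S.torsion z)⟩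

/-- An integer acts on a `p`-power-torsion element through its `p`-adic valuation: if
`a • z ∈ H` for a subgroup `H` then `p^v • z ∈ H` where `p^v ∥ a` (`a ≠ 0`). [folklore] -/
private theorem pow_zsmul_mem_of_zsmul_mem {H : AddSubgroup V} {z : V} {a : ℤ} (ha : a ≠ 0)
    (h : a • z ∈ H) : ((S.p : ℤ) ^ (multiplicity (S.p : ℤ) a)) • z ∈ H := by
  have hp := S.hp
  have hpi : Prime (S.p : ℤ) := Nat.prime_iff_prime_int.mp hp
  have hfin : FiniteMultiplicity (S.p : ℤ) a :=
    FiniteMultiplicity.of_prime_left hpi ha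
  obtain ⟨β, hβ, hndvd⟩ :
      ∃ β : ℤ, a = (S.p : ℤ) ^ multiplicity (S.p : ℤ) a * β ∧ ¬ (S.p : ℤ) ∣ β := by
    obtain ⟨β, hβ⟩ := pow_multiplicity_dvd (S.p : ℤ) a
    refine ⟨β, hβ, fun hdvd ↦ ?_⟩
    apply hfin.not_pow_dvd_of_multiplicity_lt (Nat.lt_succ_self _)
    obtain ⟨γ, rfl⟩ := hdvd
    exact Dvd.intro γ (by rw [Nat.succ_eq_add_one, pow_succ]; linear_combination (-1 : ℤ) * hβ)
  obtain ⟨u, hu⟩ := exists_mul_zsmul_eq_of_not_dvd hp S.torsion hndvd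
  have : ((S.p : ℤ) ^ multiplicity (S.p : ℤ) a) • z = u • (a • z) := by
    conv_rhs => rw [hβ, mul_comm, mul_smul, smul_smul, hu]
  rw [this]
  exact H.zsmul_mem h u

/-- **Pure eigen-lifts** (McCallum 1991, proof of Thm. 5.4: "lift `dᵢ` to `cᵢ ∈ S(E/K)`", at the
level `p^M`). A class `z ∈ Sel` which is a `ν`-eigenclass modulo `ℤx` is congruent modulo `ℤx`
to a genuine `ν`-eigenclass `z' ∈ Sel` with `⟨z'⟩ ∩ ℤx = 0`.
[cite: McCallumLMS1991, Thm. 5.4 (proof, p. 312); Lemma 5.1] -/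
theorem exists_pure_eigen_lift {z : V} (hz : z ∈ S.Sel) {ν : ℤ} (hν : ν = 1 ∨ ν = -1)
    (hτz : S.τ z - ν • z ∈ AddSubgroup.zmultiples S.x) :
    ∃ z' ∈ S.Sel, z' - z ∈ AddSubgroup.zmultiples S.x ∧ S.τ z' = ν • z' ∧
      ∀ a : ℤ, a • z' ∈ AddSubgroup.zmultiples S.x → a • z' = 0 := by
  have hp := S.hp
  have hνν : ν * ν = 1 := by rcases hν with rfl | rfl <;> norm_num
  obtain ⟨u, hu⟩ := exists_two_mul_zsmul_eq_of_pow hp S.hp2 S.torsion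
  -- Step 1: the eigen-projection `z₁ = u (z + ν τ z)`
  obtain ⟨z₁, hz₁⟩ : ∃ z₁ : V, z₁ = u • (z + ν • S.τ z) := ⟨_, rfl⟩
  have hz₁S : z₁ ∈ S.Sel :=
    hz₁ ▸ S.Sel.zsmul_mem (S.Sel.add_mem hz (S.Sel.zsmul_mem (S.τ_mem z hz) ν)) u
  have hτz₁ : S.τ z₁ = ν • z₁ := by
    rw [hz₁, map_zsmul, map_add, map_zsmul, S.τ_τ]
    linear_combination (norm := module) hνν • (-(u • S.τ z))
  have hz₁z : z₁ - z ∈ AddSubgroup.zmultiples S.x := by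
    have : z₁ - z = (u * ν) • (S.τ z - ν • z) := by
      rw [hz₁]
      linear_combination (norm := module) hνν • (u • z) + hu z
    rw [this]
    exact AddSubgroup.zsmul_mem _ hτz _
  -- Step 2: the least `n` with `p^n z₁ ∈ ℤx`, and the purity correction
  have hex : ∃ n : ℕ, ((S.p : ℤ) ^ n) • z₁ ∈ AddSubgroup.zmultiples S.x :=
    ⟨S.M, by rw [S.torsion]; exact zero_mem _⟩
  set n := Nat.find hex with hn
  have hnmem : ((S.p : ℤ) ^ n) • z₁ ∈ AddSubgroup.zmultiples S.x := Nat.find_spec hex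
  have hnmin : ∀ m < n, ((S.p : ℤ) ^ m) • z₁ ∉ AddSubgroup.zmultiples S.x := fun m hm ↦
    Nat.find_min hex hm
  obtain ⟨b, hb⟩ := AddSubgroup.mem_zmultiples_iff.mp hnmem
  -- `z' = z₁ - b' x` with `p^n z' = 0`, still a `ν`-eigenclass
  obtain ⟨b', hb'0, hb'τ⟩ : ∃ b' : ℤ, ((S.p : ℤ) ^ n) • (z₁ - b' • S.x) = 0 ∧
      S.τ (z₁ - b' • S.x) = ν • (z₁ - b' • S.x) := by
    by_cases hνε : ν = S.ε
    · obtain ⟨b', hb'⟩ := S.exists_pow_zsmul_sub_eq_zero hb.symm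
      refine ⟨b', hb', ?_⟩
      rw [map_sub, map_zsmul, hτz₁, S.τ_x, ← hνε, smul_sub, smul_comm]
    · -- opposite signs: `p^n z₁ = b x` is both a `ν`- and an `ε`-eigenvector, hence `0`
      refine ⟨0, ?_, by rw [zero_smul, sub_zero]; exact hτz₁⟩
      rw [zero_smul, sub_zero]
      have hε : -S.ε = ν := by
        rcases hν with rfl | rfl <;> rcases S.hε with h | h <;> simp_all
      have h1 : b • S.x = 0 ∧ ((S.p : ℤ) ^ n) • z₁ = 0 := by
        have := S.indep_of_eigen (y := S.x) (s := z₁) (e := S.ε) S.ε_mul_ε S.τ_x (hε ▸ hτz₁)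
          (a₀ := -b) (a₁ := (S.p : ℤ) ^ n) (by rw [neg_smul, hb, neg_add_cancel])
        simpa using this
      exact h1.2
  refine ⟨z₁ - b' • S.x, S.Sel.sub_mem hz₁S (S.Sel.zsmul_mem S.x_mem _), ?_, hb'τ, fun a ha ↦ ?_⟩
  · have : z₁ - b' • S.x - z = (z₁ - z) + (-b') • S.x := by rw [neg_smul]; abel
    rw [this]
    exact AddSubgroup.add_mem _ hz₁z (AddSubgroup.zsmul_mem _ (AddSubgroup.mem_zmultiples _) _)
  · -- purity: `a z' ∈ ℤx ⟹ a z' = 0`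
    rcases eq_or_ne a 0 with rfl | ha0
    · exact zero_smul _ _
    have hv := S.pow_zsmul_mem_of_zsmul_mem ha0 ha
    set v := multiplicity (S.p : ℤ) a with hv'
    -- `p^v z₁ ∈ ℤx`, hence `n ≤ v`, hence `p^v z' = 0`, hence `a z' = 0`
    have hv₁ : ((S.p : ℤ) ^ v) • z₁ ∈ AddSubgroup.zmultiples S.x := by
      have : ((S.p : ℤ) ^ v) • z₁ = ((S.p : ℤ) ^ v) • (z₁ - b' • S.x) + (((S.p : ℤ) ^ v) * b') • S.x := by
        rw [smul_sub, mul_smul, sub_add_cancel]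
      rw [this]
      exact AddSubgroup.add_mem _ hv (AddSubgroup.zsmul_mem _ (AddSubgroup.mem_zmultiples _) _)
    have hnv : n ≤ v := by
      by_contra h
      exact hnmin v (by omega) hv₁
    have hv0 : ((S.p : ℤ) ^ v) • (z₁ - b' • S.x) = 0 := pow_zsmul_eq_zero_of_le hnv hb'0
    obtain ⟨β, hβ⟩ := pow_multiplicity_dvd (S.p : ℤ) a
    rw [hβ, mul_comm, mul_smul, ← hv', hv0, smul_zero]

/-! ### Independence of pure lifts -/

/-- Pure lifts `s₁, …, s_m ∈ Sel` which are independent modulo `ℤx` are independent together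
with `x` (the hypothesis `hind` of `sum_expo_le_M₀_of_casselsTate`): McCallum's "`c_i` a lifting of
`d_i` to `S_∞(E/K)`", `D = D₁ × D₂ × ⋯` direct. [cite: McCallumLMS1991, Thm. 5.4 (proof, p. 312)] -/
theorem indep_of_quotient_indep {m : ℕ} {s : ℕ → V}
    (hpure : ∀ i ∈ Finset.Ioc 0 m, ∀ a : ℤ, a • s i ∈ AddSubgroup.zmultiples S.x → a • s i = 0)
    (hQ : ∀ a : ℕ → ℤ, (∑ i ∈ Finset.Ioc 0 m, a i • s i) ∈ AddSubgroup.zmultiples S.x →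
      ∀ i ∈ Finset.Ioc 0 m, a i • s i ∈ AddSubgroup.zmultiples S.x)
    (b : ℤ) (a : ℕ → ℤ) (h : b • S.x + ∑ i ∈ Finset.Ioc 0 m, a i • s i = 0) :
    b • S.x = 0 ∧ ∀ i ∈ Finset.Ioc 0 m, a i • s i = 0 := by
  have hsum : (∑ i ∈ Finset.Ioc 0 m, a i • s i) ∈ AddSubgroup.zmultiples S.x := by
    have : ∑ i ∈ Finset.Ioc 0 m, a i • s i = (-b) • S.x := by
      rw [neg_smul, eq_neg_iff_add_eq_zero, add_comm, h]
    rw [this]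
    exact AddSubgroup.zsmul_mem _ (AddSubgroup.mem_zmultiples _) _
  have h0 : ∀ i ∈ Finset.Ioc 0 m, a i • s i = 0 := fun i hi ↦ hpure i hi (a i) (hQ a hsum i hi)
  refine ⟨?_, h0⟩
  rwa [Finset.sum_eq_zero h0, add_zero] at h

/-! ### The quotient `Q = Sel/ℤx` -/

/-- Membership in `ℤx ∩ Sel` (as a subgroup of `Sel`). [folklore] -/
private theorem mem_zmultiples_addSubgroupOf_iff (z : S.Sel) :
    z ∈ (AddSubgroup.zmultiples S.x).addSubgroupOf S.Sel ↔ ∃ k : ℤ, z = k • ⟨S.x, S.x_mem⟩ := by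
  rw [AddSubgroup.mem_addSubgroupOf, AddSubgroup.mem_zmultiples_iff]
  constructor
  · rintro ⟨k, hk⟩
    exact ⟨k, Subtype.ext (by simpa using hk.symm)⟩
  · rintro ⟨k, rfl⟩
    exact ⟨k, by simp⟩

/-- `z ↦ 0` in `Sel/ℤx = Ш(E/K)_{p^M}` iff `z ∈ ℤx` (`S_{p^M}(E/K)/(E(K)/p^M) = Ш(E/K)_{p^M}`,
McCallum §2). [cite: McCallumLMS1991, §2 (the descent sequence), §5 p. 311] -/
theorem quotient_mk_eq_zero_iff (z : S.Sel) :
    (QuotientAddGroup.mk z : S.Sel ⧸ (AddSubgroup.zmultiples S.x).addSubgroupOf S.Sel) = 0 ↔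
      (z : V) ∈ AddSubgroup.zmultiples S.x := by
  rw [QuotientAddGroup.eq_zero_iff, AddSubgroup.mem_addSubgroupOf]

/-- Complex conjugation descends to an involution of `Sel/ℤx = Ш(E/K)_{p^M}` (`τ x = ε x`, Gross
Prop. 5.3; McCallum §5: "`M^±` the part of `M` on which `τ` acts by `±1`").
[cite: McCallumLMS1991, §5 p. 311] -/
theorem exists_quotient_involution :
    ∃ τQ : (S.Sel ⧸ (AddSubgroup.zmultiples S.x).addSubgroupOf S.Sel) →+
        (S.Sel ⧸ (AddSubgroup.zmultiples S.x).addSubgroupOf S.Sel),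
      (∀ z : S.Sel, τQ (QuotientAddGroup.mk z) = QuotientAddGroup.mk ⟨S.τ z, S.τ_mem z z.2⟩) ∧
      ∀ q, τQ (τQ q) = q := by
  set N := (AddSubgroup.zmultiples S.x).addSubgroupOf S.Sel with hN
  let τS : S.Sel →+ S.Sel := (S.τ.comp S.Sel.subtype).codRestrict S.Sel fun z ↦ S.τ_mem z z.2
  have hτS : ∀ z : S.Sel, (τS z : V) = S.τ z := fun z ↦ rfl
  have hNN : N ≤ N.comap τS := by
    intro z hz
    rw [hN, S.mem_zmultiples_addSubgroupOf_iff] at hz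
    obtain ⟨k, rfl⟩ := hz
    rw [AddSubgroup.mem_comap, hN, S.mem_zmultiples_addSubgroupOf_iff]
    refine ⟨k * S.ε, Subtype.ext ?_⟩
    simp only [hτS, AddSubgroupClass.coe_zsmul, map_zsmul, S.τ_x, smul_smul]
  refine ⟨QuotientAddGroup.map N N τS hNN, fun z ↦ ?_, fun q ↦ ?_⟩
  · rw [QuotientAddGroup.map_mk]
    rfl
  · induction q using QuotientAddGroup.induction_on with
    | H z =>
      rw [QuotientAddGroup.map_mk, QuotientAddGroup.map_mk]
      congr 1
      exact Subtype.ext (S.τ_τ z)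

/-- A bi-additive pairing on `Sel` vanishing against `x` on both sides descends to
`Sel/ℤx = Ш(E/K)_{p^M}` (the Cassels–Tate pairing is defined on `Ш(E/K)`, McCallum §2 (1)).
[cite: McCallumLMS1991, §2 (1), §5 p. 311] -/
theorem exists_quotient_pairing {R : Type*} [AddCommGroup R] (P : S.Sel →+ S.Sel →+ R)
    (hPx₁ : ∀ t, P ⟨S.x, S.x_mem⟩ t = 0) (hPx₂ : ∀ z, P z ⟨S.x, S.x_mem⟩ = 0) :
    ∃ B : (S.Sel ⧸ (AddSubgroup.zmultiples S.x).addSubgroupOf S.Sel) →+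
        (S.Sel ⧸ (AddSubgroup.zmultiples S.x).addSubgroupOf S.Sel) →+ R,
      ∀ z t : S.Sel, B (QuotientAddGroup.mk z) (QuotientAddGroup.mk t) = P z t := by
  set N := (AddSubgroup.zmultiples S.x).addSubgroupOf S.Sel with hN
  have hker : ∀ z : S.Sel, N ≤ (P z).ker := by
    intro z t ht
    rw [hN, S.mem_zmultiples_addSubgroupOf_iff] at ht
    obtain ⟨k, rfl⟩ := ht
    rw [AddMonoidHom.mem_ker, map_zsmul, hPx₂, smul_zero]
  let φ : S.Sel →+ ((S.Sel ⧸ N) →+ R) :=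
    AddMonoidHom.mk' (fun z ↦ QuotientAddGroup.lift N (P z) (hker z)) fun z z' ↦ by
      apply QuotientAddGroup.addMonoidHom_ext
      ext t
      simp only [AddMonoidHom.coe_comp, Function.comp_apply, QuotientAddGroup.mk'_apply,
        QuotientAddGroup.lift_mk, map_add, AddMonoidHom.add_apply]
  have hφ : ∀ z t : S.Sel, φ z (QuotientAddGroup.mk t) = P z t := fun z t ↦ by
    simp only [φ, AddMonoidHom.mk'_apply, QuotientAddGroup.lift_mk]
  have hkerφ : N ≤ φ.ker := by
    intro z hz
    rw [hN, S.mem_zmultiples_addSubgroupOf_iff] at hz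
    obtain ⟨k, rfl⟩ := hz
    rw [AddMonoidHom.mem_ker]
    apply QuotientAddGroup.addMonoidHom_ext
    ext t
    simp only [AddMonoidHom.coe_comp, Function.comp_apply, QuotientAddGroup.mk'_apply, hφ,
      map_zsmul, AddMonoidHom.zsmul_apply, hPx₁, smul_zero, AddMonoidHom.zero_apply]
  refine ⟨QuotientAddGroup.lift N φ hkerφ, fun z t ↦ ?_⟩
  rw [QuotientAddGroup.lift_mk, hφ]

/-- `#Sel = p^M · #(Sel/ℤx)`: `ord x = p^M` (`x₀ ∉ pE(K) + E(K)_{tors}`, `E(K)/p^M ↪ S_{p^M}(E/K)`,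
McCallum Lemma 5.1). [cite: McCallumLMS1991, Lemma 5.1, §2] -/
theorem card_sel_eq :
    Nat.card S.Sel =
      S.p ^ S.M * Nat.card (S.Sel ⧸ (AddSubgroup.zmultiples S.x).addSubgroupOf S.Sel) := by
  have hle : AddSubgroup.zmultiples S.x ≤ S.Sel := AddSubgroup.zmultiples_le.mpr S.x_mem
  rw [AddSubgroup.card_eq_card_quotient_mul_card_addSubgroup
    ((AddSubgroup.zmultiples S.x).addSubgroupOf S.Sel), mul_comm,
    Nat.card_congr (AddSubgroup.addSubgroupOfEquivOfLe hle).toEquiv, Nat.card_zmultiples,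
    addOrderOf_eq_prime_pow S.hp (S.torsion S.x) S.x_ord]

/-- `Sel/ℤx` is killed by `p^M`. [folklore] -/
private theorem pow_zsmul_quotient_eq_zero
    (q : S.Sel ⧸ (AddSubgroup.zmultiples S.x).addSubgroupOf S.Sel) :
    ((S.p : ℤ) ^ S.M) • q = 0 := by
  induction q using QuotientAddGroup.induction_on with
  | H z =>
    rw [← QuotientAddGroup.mk_zsmul, show ((S.p : ℤ) ^ S.M) • z = 0 from
      Subtype.ext (by simpa using S.torsion (z : V)), QuotientAddGroup.mk_zero]

/-- `Sel/ℤx = Ш(E/K)_{p^M}` has odd order when `Sel` is finite (`p` is an odd prime, McCallum §5: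
"`p` is an odd prime such that …"). [cite: McCallumLMS1991, §5 p. 311] -/
theorem odd_card_quotient [Finite S.Sel] :
    Odd (Nat.card (S.Sel ⧸ (AddSubgroup.zmultiples S.x).addSubgroupOf S.Sel)) := by
  rw [← Nat.not_even_iff_odd]
  rintro ⟨k, hk⟩
  haveI : Fact (Nat.Prime 2) := ⟨Nat.prime_two⟩
  obtain ⟨q, hq⟩ := exists_prime_addOrderOf_dvd_card' (G := S.Sel ⧸
    (AddSubgroup.zmultiples S.x).addSubgroupOf S.Sel) 2 ⟨k, by rw [hk]; ring⟩
  have h2 : (2 : ℕ) ∣ S.p ^ S.M := by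
    rw [← hq]
    apply addOrderOf_dvd_of_nsmul_eq_zero
    rw [← natCast_zsmul]
    push_cast
    exact S.pow_zsmul_quotient_eq_zero q
  exact S.hp2 ((Nat.prime_dvd_prime_iff_eq Nat.prime_two S.hp).mp
    (Nat.prime_two.dvd_of_dvd_pow h2)).symm

end HypothesesM

end KolyvaginDescent

end Literature.NumberTheory.EllipticCurves
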